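import Literature.Probability.LatticeModels.StrongHarrisKleitman
import Literature.Probability.Percolation.PercolationEvents
import HarnessLib

/-!
# Gladkov's strong Harris–Kleitman inequality for the trace of an open cluster on a relay set

Topic `Literature/Probability/Percolation`.  Bernoulli bond percolation with arbitrary edge
probabilities on a finite vertex type `V` (`μ = prodBernoulli w` on `BondConfig V = Set (Sym2 V)`),
an observer `o`, a finite relay set `A`, and the random TRACE `S(ω) := {a ∈ A : o ↔ a}` of the open
cluster of `o` on `A` (`N = |S|` is the count of the route
`Summits/CriticalPhenomena/PercolationContinuityZ3/Theses/PercNearOneGluingNoHeavy`, crux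
`NoHeavyLowerTail`, stmt-CriticalPhenomena-4575, whose one-cut engine bounds the law of `S`).

Everything here is a PROVED corollary of Gladkov's Theorem 2.1
(`Literature.Probability.LatticeModels.prodBernoulli_strongHarris`, file
`LatticeModels/StrongHarrisKleitman.lean`): N. Gladkov, *A strong FKG inequality for multiple
events*, Bull. Lond. Math. Soc. 56 (2024), doi:10.1112/blms.13101 = arXiv:2305.02653, Thm. 2.1 —
"Let `μ` be a probability product measure on `H_n`, and `H_n = A ⊔ C_1 ⊔ ⋯ ⊔ C_k ⊔ B` for `k ≥ 2` such
that all sets of the form `A ∪ C_i` are closed upwards. Then `μ(A) μ(B) ≥ e_2(μ(C_1), …, μ(C_k))`."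

## The corollary (not stated in print; immediate from Thm. 2.1)

For an ANTICHAIN `𝒮` of subsets of `A` take the cells `C_S = {S(ω) = S}` (`S ∈ 𝒮`), the top cell
`T = {S(ω) ⊋ S for some S ∈ 𝒮}` and the bottom cell `B = {S(ω) ⊉ S for every S ∈ 𝒮}`.  Since
`o ↔ a` is increasing, `T ∪ C_S = {S(ω) ⊇ S}` minus nothing is closed upwards, `T` is closed upwards,
and the antichain condition makes `T`, the `C_S` and `B` a partition.  Hence

  `(Σ_{S ∈ 𝒮} μ(S(ω) = S))² − Σ_{S ∈ 𝒮} μ(S(ω) = S)² ≤ 2 · μ(T) · μ(B)`,             (⋆)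

i.e. `Σ_{S ≠ S' ∈ 𝒮} μ(S(ω)=S) μ(S(ω)=S') ≤ 2 μ(T) μ(B)`: an "entropy-free" bound on the total mass
of any antichain of popular traces by ONE product (compare the pairwise bounds of
van den Berg–Häggström–Kahn type in `TwoSeparationSets.lean`).  Two instances are spelled out:

* `prodBernoulli_traceAntichain_strongHarris` — (⋆) for a general antichain `𝒮 ⊆ 𝒫(A)`;
* `prodBernoulli_traceSingletons_strongHarris` — `𝒮 = {{a} : a ∈ A}`:
  `(Σ_a μ(S = {a}))² − Σ_a μ(S = {a})² ≤ 2 μ(N ≥ 2) μ(N = 0)` ("lonely relays", cf. Kozma–Nitzan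
  arXiv:2401.12397 Lemma 2, which bounds `Σ_a μ(S = {a})` linearly under a pairwise-connection
  hypothesis; (⋆) is hypothesis-free but quadratic).

Events are written in the vocabulary of the route's theorem files
(`{ω | ∀ a ∈ A, ω ∈ openConn o a ↔ a ∈ S}` for `{S(ω) = S}`).

## References

* N. Gladkov, *A strong FKG inequality for multiple events*, Bull. Lond. Math. Soc. 56 (2024),
  Thm. 2.1. [Gladkov2024StrongFKG]
* G. Kozma, S. Nitzan, *A reduction of the θ(p_c) = 0 problem to a conjectured inequality*,
  arXiv:2401.12397 (2024), Lemma 2 (context only). [KozmaNitzan2024]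
-/

noncomputable section

namespace Literature.Probability.Percolation

open MeasureTheory Literature.Probability.LatticeModels

variable {V : Type*} [Finite V]

/-- **Strong Harris–Kleitman bound for an antichain of traces.**  `μ = prodBernoulli w` on
`BondConfig V` (`V` finite), observer `o`, relay set `A`, `𝒮` an antichain of subsets of `A`.  With
the cells `{S(ω) = S}` (`S ∈ 𝒮`), top `{∃ S ∈ 𝒮, S ⊊ S(ω)}` and bottom `{∀ S ∈ 𝒮, S ⊄ S(ω)}`
(`S(ω) = {a ∈ A : o ↔ a}`):
`(Σ_{S∈𝒮} μ{S(ω)=S})² − Σ_{S∈𝒮} μ{S(ω)=S}² ≤ 2 μ(top) μ(bottom)`.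
[cite: Gladkov2024StrongFKG, Thm. 2.1 — corollary] -/
theorem prodBernoulli_traceAntichain_strongHarris (w : Sym2 V → unitInterval) (A : Finset V) (o : V)
    (𝒮 : Finset (Finset V)) (h𝒮A : ∀ S ∈ 𝒮, S ⊆ A)
    (h𝒮 : ∀ S ∈ 𝒮, ∀ S' ∈ 𝒮, S ⊆ S' → S = S') :
    (∑ S ∈ 𝒮, (prodBernoulli w).real {ω : BondConfig V | ∀ a ∈ A, ω ∈ openConn o a ↔ a ∈ S}) ^ 2 -
        ∑ S ∈ 𝒮, (prodBernoulli w).real {ω : BondConfig V | ∀ a ∈ A, ω ∈ openConn o a ↔ a ∈ S} ^ 2 ≤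
      2 * ((prodBernoulli w).real
              {ω : BondConfig V | ∃ S ∈ 𝒮, (∀ a ∈ S, ω ∈ openConn o a) ∧
                ∃ a ∈ A, a ∉ S ∧ ω ∈ openConn o a} *
            (prodBernoulli w).real {ω : BondConfig V | ∀ S ∈ 𝒮, ∃ a ∈ S, ω ∉ openConn o a}) := by
  classical
  -- the cells, the top and the bottom of Gladkov's theorem
  set C : Finset V → Set (BondConfig V) := fun S => {ω | ∀ a ∈ A, ω ∈ openConn o a ↔ a ∈ S} with hC
  set T : Set (BondConfig V) := {ω | ∃ S ∈ 𝒮, (∀ a ∈ S, ω ∈ openConn o a) ∧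
    ∃ a ∈ A, a ∉ S ∧ ω ∈ openConn o a} with hT
  have hdisj : ∀ S ∈ 𝒮, ∀ S' ∈ 𝒮, S ≠ S' → Disjoint (C S) (C S') := by
    intro S hS S' hS' hne
    refine Set.disjoint_left.2 fun ω h1 h2 => hne ?_
    ext a
    constructor
    · intro ha; exact (h2 a (h𝒮A S hS ha)).1 ((h1 a (h𝒮A S hS ha)).2 ha)
    · intro ha; exact (h1 a (h𝒮A S' hS' ha)).1 ((h2 a (h𝒮A S' hS' ha)).2 ha)
  have hdisjT : ∀ S ∈ 𝒮, Disjoint T (C S) := by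
    intro S hS
    refine Set.disjoint_left.2 fun ω hω hCω => ?_
    obtain ⟨S', hS', hall, a, haA, haS', hoa⟩ := hω
    -- `S' ⊆ S(ω) = S` and `a ∈ S ∖ S'`: contradicts the antichain condition
    have hsub : S' ⊆ S := fun b hb => (hCω b (h𝒮A S' hS' hb)).1 (hall b hb)
    have haS : a ∈ S := (hCω a haA).1 hoa
    rw [h𝒮 S' hS' S hS hsub] at haS'
    exact haS' haS
  have hup : ∀ S ∈ 𝒮, IsUpperSet (T ∪ C S) := by
    intro S hS ω ω' hle hω
    -- the trace only grows along `ω ≤ ω'`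
    have hmono : ∀ a, ω ∈ openConn o a → ω' ∈ openConn o a := fun a h => isUpperSet_openConn o a hle h
    rcases hω with hω | hω
    · obtain ⟨S', hS', hall, a, haA, haS', hoa⟩ := hω
      exact Or.inl ⟨S', hS', fun b hb => hmono b (hall b hb), a, haA, haS', hmono a hoa⟩
    · by_cases hex : ∃ a ∈ A, a ∉ S ∧ ω' ∈ openConn o a
      · exact Or.inl ⟨S, hS, fun b hb => hmono b ((hω b (h𝒮A S hS hb)).2 hb), hex⟩
      · push Not at hex
        refine Or.inr fun a ha => ⟨fun h => ?_, fun h => hmono a ((hω a ha).2 h)⟩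
        by_contra haS
        exact hex a ha haS h
  have hupT : IsUpperSet T := by
    intro ω ω' hle hω
    obtain ⟨S', hS', hall, a, haA, haS', hoa⟩ := hω
    exact ⟨S', hS', fun b hb => isUpperSet_openConn o b hle (hall b hb), a, haA, haS',
      isUpperSet_openConn o a hle hoa⟩
  have key := prodBernoulli_strongHarris w 𝒮 hdisj hdisjT hup hupT
  -- identify the bottom cell
  have hB : (T ∪ ⋃ S ∈ 𝒮, C S)ᶜ = {ω : BondConfig V | ∀ S ∈ 𝒮, ∃ a ∈ S, ω ∉ openConn o a} := by
    ext ω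
    simp only [Set.mem_compl_iff, Set.mem_union, Set.mem_iUnion, exists_prop, not_or, not_exists,
      not_and, Set.mem_setOf_eq]
    constructor
    · rintro ⟨hT', hC'⟩ S hS
      by_contra hno
      push Not at hno
      -- all of `S` is joined to `o`; then either the trace is exactly `S` or strictly bigger
      by_cases hex : ∃ a ∈ A, a ∉ S ∧ ω ∈ openConn o a
      · exact hT' ⟨S, hS, hno, hex⟩
      · push Not at hex
        exact hC' S hS fun a ha => ⟨fun h => by by_contra haS; exact hex a ha haS h,
          fun h => hno a h⟩
    · intro h
      refine ⟨?_, fun S hS hCω => ?_⟩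
      · rintro ⟨S', hS', hall, -⟩
        obtain ⟨a, ha, hna⟩ := h S' hS'
        exact hna (hall a ha)
      · obtain ⟨a, ha, hna⟩ := h S hS
        exact hna ((hCω a (h𝒮A S hS ha)).2 ha)
  rw [hB] at key
  exact key

/-- **Strong Harris–Kleitman bound for lonely relays.**  With `N(ω) = |{a ∈ A : o ↔ a}|`:
`(Σ_{a∈A} μ{S(ω) = {a}})² − Σ_{a∈A} μ{S(ω) = {a}}² ≤ 2 μ{N ≥ 2} μ{N = 0}`, the events written as
`{S(ω) = {a}} = {∀ b ∈ A, o ↔ b ↔ b = a}`, `{N ≥ 2} = {∃ a ≠ b ∈ A, o ↔ a ∧ o ↔ b}`,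
`{N = 0} = {∀ a ∈ A, o ↮ a}`.  (Gladkov's theorem with the singleton antichain; hypothesis-free,
quadratic companion of Kozma–Nitzan's Lemma 2.) [cite: Gladkov2024StrongFKG, Thm. 2.1 — corollary] -/
theorem prodBernoulli_traceSingletons_strongHarris (w : Sym2 V → unitInterval) (A : Finset V) (o : V) :
    (∑ a ∈ A, (prodBernoulli w).real {ω : BondConfig V | ∀ b ∈ A, ω ∈ openConn o b ↔ b = a}) ^ 2 -
        ∑ a ∈ A, (prodBernoulli w).real {ω : BondConfig V | ∀ b ∈ A, ω ∈ openConn o b ↔ b = a} ^ 2 ≤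
      2 * ((prodBernoulli w).real
              {ω : BondConfig V | ∃ a ∈ A, ∃ b ∈ A, a ≠ b ∧ ω ∈ openConn o a ∧ ω ∈ openConn o b} *
            (prodBernoulli w).real {ω : BondConfig V | ∀ a ∈ A, ω ∉ openConn o a}) := by
  classical
  have key := prodBernoulli_traceAntichain_strongHarris w A o (A.image fun a => ({a} : Finset V))
    (by
      intro S hS
      obtain ⟨a, ha, rfl⟩ := Finset.mem_image.1 hS
      exact Finset.singleton_subset_iff.2 ha)
    (by
      intro S hS S' hS' hSS'
      obtain ⟨a, -, rfl⟩ := Finset.mem_image.1 hS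
      obtain ⟨b, -, rfl⟩ := Finset.mem_image.1 hS'
      have : a ∈ ({b} : Finset V) := hSS' (Finset.mem_singleton_self a)
      rw [Finset.mem_singleton.1 this])
  have hinj : Set.InjOn (fun a => ({a} : Finset V)) ↑A := fun a _ b _ h =>
    Finset.singleton_injective h
  rw [Finset.sum_image hinj, Finset.sum_image hinj] at key
  -- identify the events
  have e1 : ∀ a ∈ A, {ω : BondConfig V | ∀ b ∈ A, ω ∈ openConn o b ↔ b ∈ ({a} : Finset V)} =
      {ω : BondConfig V | ∀ b ∈ A, ω ∈ openConn o b ↔ b = a} := by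
    intro a _; ext ω; simp only [Set.mem_setOf_eq, Finset.mem_singleton]
  have e2 : {ω : BondConfig V | ∃ S ∈ A.image (fun a => ({a} : Finset V)),
      (∀ a ∈ S, ω ∈ openConn o a) ∧ ∃ a ∈ A, a ∉ S ∧ ω ∈ openConn o a} =
      {ω : BondConfig V | ∃ a ∈ A, ∃ b ∈ A, a ≠ b ∧ ω ∈ openConn o a ∧ ω ∈ openConn o b} := by
    ext ω
    simp only [Set.mem_setOf_eq, Finset.mem_image]
    constructor
    · rintro ⟨S, ⟨a, ha, rfl⟩, hall, b, hb, hbS, hob⟩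
      refine ⟨a, ha, b, hb, fun hab => hbS (by rw [hab]; exact Finset.mem_singleton_self b),
        hall a (Finset.mem_singleton_self a), hob⟩
    · rintro ⟨a, ha, b, hb, hab, hoa, hob⟩
      refine ⟨{a}, ⟨a, ha, rfl⟩, fun c hc => by rw [Finset.mem_singleton.1 hc]; exact hoa, b, hb,
        fun h => hab (Finset.mem_singleton.1 h).symm, hob⟩
  have e3 : {ω : BondConfig V | ∀ S ∈ A.image (fun a => ({a} : Finset V)), ∃ a ∈ S, ω ∉ openConn o a} =
      {ω : BondConfig V | ∀ a ∈ A, ω ∉ openConn o a} := by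
    ext ω
    simp only [Set.mem_setOf_eq, Finset.mem_image]
    constructor
    · intro h a ha
      obtain ⟨c, hc, hnc⟩ := h {a} ⟨a, ha, rfl⟩
      rw [Finset.mem_singleton.1 hc] at hnc
      exact hnc
    · rintro h S ⟨a, ha, rfl⟩
      exact ⟨a, Finset.mem_singleton_self a, h a ha⟩
  have s1 : ∑ a ∈ A, (prodBernoulli w).real
        {ω : BondConfig V | ∀ b ∈ A, ω ∈ openConn o b ↔ b ∈ ({a} : Finset V)} =
      ∑ a ∈ A, (prodBernoulli w).real {ω : BondConfig V | ∀ b ∈ A, ω ∈ openConn o b ↔ b = a} :=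
    Finset.sum_congr rfl fun a ha => by rw [e1 a ha]
  have s2 : ∑ a ∈ A, (prodBernoulli w).real
        {ω : BondConfig V | ∀ b ∈ A, ω ∈ openConn o b ↔ b ∈ ({a} : Finset V)} ^ 2 =
      ∑ a ∈ A, (prodBernoulli w).real {ω : BondConfig V | ∀ b ∈ A, ω ∈ openConn o b ↔ b = a} ^ 2 :=
    Finset.sum_congr rfl fun a ha => by rw [e1 a ha]
  rw [s1, s2, e2, e3] at key
  exact key

end Literature.Probability.Percolation
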